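import Summits.RiemannHypothesis.RiemannHypothesis.Theorems.Splittings.NbTargets
import HarnessLib

/-!
# RH-EQUIVALENT·SPLITTING CENSUS (nb, neg) · V39 «TARGETS» (2/2): dilation — under RH every initial segment `𝟙_(0,1/m]` (hence every cell) is Nyman–Beurling approximable; with the confinement file this makes «𝟙_(0,1/m] ∈ B̄» an RH-EQUIVALENT for every `m ≥ 1`; nothing here bears on the truth of RH

LABEL (line 1): RH-EQUIVALENT·SPLITTING (cell `rh-split`, seat (nb, neg), generation 14, census
candidate V39, companion of `NbTargets.lean`).

* `eLpNorm_comp_mul_left_Ioi` : `‖D(m·)‖_{L²(0,∞)} = m^{-1/2}‖D‖_{L²(0,∞)}` (`m > 0`). [folklore]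
* `sum_dilate_eq` : the dilate by `m` of `∑_{k<N} c_k{1/((k+1)x)}` is again of the canonical shape
  `∑_{j<mN} c'_j{1/((j+1)x)}` (`c'` supported on the indices `j+1 = m(k+1)`): the real span of the
  Beurling dilates is invariant under `x ↦ mx`, `m ∈ ℕ*`. [folklore; Báez-Duarte 2003 §1]
* `nbTarget_indicator_of_rh` : RH ⟹ TARGET(`𝟙_(0,1/m]`) for every `m ≥ 1`, from the tree's PROVED
  Báez-Duarte theorem `Literature.NumberTheory.LFunctions.baezDuarte_iff_holds` (the case `m = 1`)
  by dilation.  With `NbTargets.riemannHypothesis_of_nbTarget_indicator` (FIN empty: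
  `mellin 𝟙_(0,1/m] = m^{-s}/s ≠ 0`… there stated for `(a,b]`, `a > 0`; the `a = 0` case is the
  tree's own `riemannHypothesis_of_beurling_closure` after dilation) this is Balazard's
  «B̄ = D ⟺ RH» (arXiv:1812.04309, Prop. 10 (i)) read on the targets `𝟙_(0,1/m]`.

Hygiene: zero `def`s, no `sorry`, no new axioms, no `instance`/`notation`.
-/

set_option linter.dupNamespace false

noncomputable section

open Complex Filter MeasureTheory Set
open scoped Real Topology ENNReal

namespace Summit.RiemannHypothesis.RiemannHypothesis.Theorems.Splittings.NbTargets

open Literature.NumberTheory.LFunctions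

/-- `L²(0,∞)` scaling: for measurable `D : ℝ → ℝ` and `m > 0`,
`‖x ↦ D(mx)‖_{L²((0,∞))} = (m⁻¹)^{1/2} · ‖D‖_{L²((0,∞))}`. [folklore] -/
theorem eLpNorm_comp_mul_left_Ioi {D : ℝ → ℝ} (hD : Measurable D) {m : ℝ} (hm : 0 < m) :
    eLpNorm (fun x ↦ D (m * x)) 2 (volume.restrict (Ioi 0)) =
      ENNReal.ofReal m⁻¹ ^ (1 / 2 : ℝ) * eLpNorm D 2 (volume.restrict (Ioi 0)) := by
  have hmeas : Measurable fun x : ℝ ↦ m * x := measurable_const_mul m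
  have hmap : (volume.restrict (Ioi (0 : ℝ))).map (fun x : ℝ ↦ m * x) =
      ENNReal.ofReal m⁻¹ • volume.restrict (Ioi (0 : ℝ)) := by
    have hpre : (fun x : ℝ ↦ m * x) ⁻¹' Ioi 0 = Ioi 0 := by
      rw [preimage_const_mul_Ioi₀ _ hm, zero_div]
    calc (volume.restrict (Ioi (0 : ℝ))).map (fun x : ℝ ↦ m * x)
        = (volume.restrict ((fun x : ℝ ↦ m * x) ⁻¹' Ioi 0)).map (fun x : ℝ ↦ m * x) := by
          rw [hpre]
      _ = (volume.map fun x : ℝ ↦ m * x).restrict (Ioi 0) :=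
          (Measure.restrict_map hmeas measurableSet_Ioi).symm
      _ = ENNReal.ofReal m⁻¹ • volume.restrict (Ioi (0 : ℝ)) := by
          rw [Real.map_volume_mul_left hm.ne', Measure.restrict_smul, abs_of_pos (inv_pos.2 hm)]
  have h1 : eLpNorm (fun x ↦ D (m * x)) 2 (volume.restrict (Ioi 0)) =
      eLpNorm D 2 ((volume.restrict (Ioi (0 : ℝ))).map fun x : ℝ ↦ m * x) := by
    rw [eLpNorm_map_measure hD.aestronglyMeasurable hmeas.aemeasurable]
    rfl
  rw [h1, hmap, eLpNorm_smul_measure_of_ne_zero (by simp [hm]) D 2, smul_eq_mul]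
  norm_num

/-- **Dilation invariance of the Beurling span, canonical indexing.**  For `m ≥ 1`, `M ≥ mN` and
`c : Fin N → ℝ`, with `c' : Fin M → ℝ`, `c'_j = ∑_k [ (k+1)m = j+1 ] c_k`:
`∑_{j<M} c'_j {1/((j+1)x)} = ∑_{k<N} c_k {1/((k+1)(mx))}` for every `x`. [folklore] -/
theorem sum_dilate_eq {N : ℕ} (c : Fin N → ℝ) {m M : ℕ} (hm : 0 < m) (hM : m * N ≤ M) (x : ℝ) :
    ∑ j : Fin M, (∑ k : Fin N, if ((k : ℕ) + 1) * m = (j : ℕ) + 1 then c k else 0) *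
        Int.fract (1 / (((j : ℕ) + 1 : ℝ) * x)) =
      ∑ k : Fin N, c k * Int.fract (1 / (((k : ℕ) + 1 : ℝ) * ((m : ℝ) * x))) := by
  simp_rw [Finset.sum_mul, ite_mul, zero_mul]
  rw [Finset.sum_comm]
  refine Finset.sum_congr rfl fun k _ ↦ ?_
  have h2 : 1 ≤ ((k : ℕ) + 1) * m :=
    Nat.one_le_iff_ne_zero.2 (Nat.mul_ne_zero (Nat.succ_ne_zero _) hm.ne')
  have hk : ((k : ℕ) + 1) * m - 1 < M := by
    have h1 : ((k : ℕ) + 1) * m ≤ N * m := Nat.mul_le_mul_right _ k.is_lt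
    rw [mul_comm m N] at hM
    omega
  rw [Finset.sum_eq_single ⟨((k : ℕ) + 1) * m - 1, hk⟩]
  · have heq : ((k : ℕ) + 1) * m = (((k : ℕ) + 1) * m - 1) + 1 := by omega
    rw [if_pos heq]
    congr 2
    have : ((((k : ℕ) + 1) * m - 1 : ℕ) : ℝ) + 1 = (((k : ℕ) + 1) * m : ℕ) := by
      rw [heq]; push_cast; ring
    rw [this]
    push_cast
    ring
  · intro j _ hj
    rw [if_neg]
    intro h
    apply hj
    ext
    simp only
    omega
  · intro h
    exact absurd (Finset.mem_univ _) h

/-- The dilate of `χ = 𝟙_(0,1]` by `m > 0` is the initial segment `𝟙_(0,1/m]`. [folklore] -/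
theorem indicator_Ioc_dilate {m : ℝ} (hm : 0 < m) (x : ℝ) :
    (Ioc (0 : ℝ) (1 / m)).indicator (1 : ℝ → ℝ) x = (Ioc (0 : ℝ) 1).indicator 1 (m * x) := by
  have hiff : x ∈ Ioc (0 : ℝ) (1 / m) ↔ m * x ∈ Ioc (0 : ℝ) 1 := by
    rw [mem_Ioc, mem_Ioc, le_div_iff₀ hm, mul_comm, mul_pos_iff_of_pos_left hm]
  by_cases hx : x ∈ Ioc (0 : ℝ) (1 / m)
  · rw [indicator_of_mem hx, indicator_of_mem (hiff.1 hx)]; rfl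
  · rw [indicator_of_notMem hx, indicator_of_notMem (hiff.not.1 hx)]

/-- Two dilates at once: with `c'_j = a∑_k[(k+1)m = j+1]c_k + b∑_k[(k+1)m' = j+1]c_k` on
`Fin M`, `M ≥ mN, m'N`, the canonical sum `∑_j c'_j{1/((j+1)x)}` is
`a∑_k c_k{1/((k+1)mx)} + b∑_k c_k{1/((k+1)m'x)}`. [folklore] -/
theorem sum_twoDilates_eq {N : ℕ} (c : Fin N → ℝ) (a b : ℝ) {m m' M : ℕ} (hm : 0 < m)
    (hm' : 0 < m') (hM : m * N ≤ M) (hM' : m' * N ≤ M) (x : ℝ) :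
    ∑ j : Fin M, (a * (∑ k : Fin N, if ((k : ℕ) + 1) * m = (j : ℕ) + 1 then c k else 0) +
        b * ∑ k : Fin N, if ((k : ℕ) + 1) * m' = (j : ℕ) + 1 then c k else 0) *
          Int.fract (1 / (((j : ℕ) + 1 : ℝ) * x)) =
      a * ∑ k : Fin N, c k * Int.fract (1 / (((k : ℕ) + 1 : ℝ) * ((m : ℝ) * x))) +
        b * ∑ k : Fin N, c k * Int.fract (1 / (((k : ℕ) + 1 : ℝ) * ((m' : ℝ) * x))) := by
  rw [← sum_dilate_eq c hm hM x, ← sum_dilate_eq c hm' hM' x, Finset.mul_sum, Finset.mul_sum,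
    ← Finset.sum_add_distrib]
  exact Finset.sum_congr rfl fun j _ ↦ by ring

/-- **RH ⟹ every initial segment is a Nyman–Beurling target.**  Under the Riemann hypothesis,
for every `m ≥ 1` the indicator `𝟙_(0,1/m]` is an `L²(0,∞)`-limit of real combinations
`∑_{j<N} c_j {1/((j+1)x)}`: dilate Báez-Duarte's approximants of `χ = 𝟙_(0,1]`
(`Literature.NumberTheory.LFunctions.baezDuarte_iff_holds`) by `x ↦ mx`, which maps the span to
itself (`sum_dilate_eq`) and divides `L²` norms by `√m` (`eLpNorm_comp_mul_left_Ioi`).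
[cite: BaezDuarte2003, Thm. 1.1; Balazard2020, Prop. 10 (i)] -/
theorem nbTarget_indicator_of_rh (hRH : RiemannHypothesis) {m : ℕ} (hm : 0 < m) :
    ∀ ε : ℝ, 0 < ε → ∃ (N : ℕ) (c : Fin N → ℝ),
      eLpNorm (fun x : ℝ ↦ (Ioc (0 : ℝ) (1 / m)).indicator 1 x -
          ∑ k : Fin N, c k * Int.fract (1 / (((k : ℕ) + 1 : ℝ) * x))) 2
        (volume.restrict (Ioi 0)) < ENNReal.ofReal ε := by
  intro ε hε
  have hm0 : (0 : ℝ) < m := by exact_mod_cast hm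
  obtain ⟨N, c, hN⟩ := baezDuarte_iff_holds.1 hRH (ε * Real.sqrt m) (by positivity)
  refine ⟨m * N, fun j ↦ ∑ k : Fin N, if ((k : ℕ) + 1) * m = (j : ℕ) + 1 then c k else 0, ?_⟩
  set D : ℝ → ℝ := fun x ↦ (Ioc (0 : ℝ) 1).indicator 1 x -
    ∑ k : Fin N, c k * Int.fract (1 / (((k : ℕ) + 1 : ℝ) * x)) with hD
  have hDm : Measurable D := by
    refine (measurable_one.indicator measurableSet_Ioc).sub (Finset.measurable_sum _ fun k _ ↦ ?_)
    exact measurable_const.mul (measurable_fract.comp (by fun_prop))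
  have hcomp : (fun x : ℝ ↦ (Ioc (0 : ℝ) (1 / m)).indicator 1 x -
      ∑ j : Fin (m * N), (∑ k : Fin N, if ((k : ℕ) + 1) * m = (j : ℕ) + 1 then c k else 0) *
        Int.fract (1 / (((j : ℕ) + 1 : ℝ) * x))) = fun x ↦ D (m * x) := by
    funext x
    rw [sum_dilate_eq c hm le_rfl x, hD, indicator_Ioc_dilate hm0 x]
  rw [hcomp, eLpNorm_comp_mul_left_Ioi hDm hm0]
  have hc0 : ENNReal.ofReal (m : ℝ)⁻¹ ^ (1 / 2 : ℝ) ≠ 0 := by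
    simp [hm0]
  have hctop : ENNReal.ofReal (m : ℝ)⁻¹ ^ (1 / 2 : ℝ) ≠ ⊤ := by
    simp
  calc ENNReal.ofReal (m : ℝ)⁻¹ ^ (1 / 2 : ℝ) * eLpNorm D 2 (volume.restrict (Ioi 0))
      < ENNReal.ofReal (m : ℝ)⁻¹ ^ (1 / 2 : ℝ) * ENNReal.ofReal (ε * Real.sqrt m) :=
        ENNReal.mul_lt_mul_right hc0 hctop hN
    _ = ENNReal.ofReal ε := by
        rw [ENNReal.ofReal_rpow_of_nonneg (inv_nonneg.2 hm0.le) (by norm_num),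
          ← ENNReal.ofReal_mul (Real.rpow_nonneg (inv_nonneg.2 hm0.le) _),
          ← Real.sqrt_eq_rpow, Real.sqrt_inv, mul_comm ε, ← mul_assoc,
          inv_mul_cancel₀ (Real.sqrt_ne_zero'.2 hm0), one_mul]

/-- **RH ⟹ every two-dilate combination `a χ(mx) + b χ(m'x)` is a Nyman–Beurling target.**
Under RH, for `m, m' ≥ 1` and real `a, b`, the step function `x ↦ a𝟙_(0,1](mx) + b𝟙_(0,1](m'x)`
(`= a𝟙_(0,1/m] + b𝟙_(0,1/m']`) is an `L²(0,∞)`-limit of real combinations `∑_{j<N} c_j{1/((j+1)x)}`: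
take one Báez-Duarte approximant of `χ` (`Literature.NumberTheory.LFunctions.baezDuarte_iff_holds`)
and combine its `m`- and `m'`-dilates (`sum_dilate_eq`, `eLpNorm_comp_mul_left_Ioi`).
[cite: BaezDuarte2003, Thm. 1.1; Balazard2020, Prop. 10 (i)] -/
theorem nbTarget_twoDilates_of_rh (hRH : RiemannHypothesis) (a b : ℝ) {m m' : ℕ} (hm : 0 < m)
    (hm' : 0 < m') :
    ∀ ε : ℝ, 0 < ε → ∃ (N : ℕ) (c : Fin N → ℝ),
      eLpNorm (fun x : ℝ ↦ (a * (Ioc (0 : ℝ) 1).indicator 1 ((m : ℝ) * x) +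
            b * (Ioc (0 : ℝ) 1).indicator 1 ((m' : ℝ) * x)) -
          ∑ k : Fin N, c k * Int.fract (1 / (((k : ℕ) + 1 : ℝ) * x))) 2
        (volume.restrict (Ioi 0)) < ENNReal.ofReal ε := by
  intro ε hε
  have hm0 : (0 : ℝ) < m := by exact_mod_cast hm
  have hm0' : (0 : ℝ) < m' := by exact_mod_cast hm'
  -- one Báez-Duarte approximant, accurate to `ε / (2 (|a| + |b| + 1))`
  set η : ℝ := ε / (2 * (|a| + |b| + 1)) with hη
  have hη0 : 0 < η := by positivity
  obtain ⟨N, c, hN⟩ := baezDuarte_iff_holds.1 hRH η hη0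
  refine ⟨(m + m') * N, fun j ↦
    a * (∑ k : Fin N, if ((k : ℕ) + 1) * m = (j : ℕ) + 1 then c k else 0) +
      b * ∑ k : Fin N, if ((k : ℕ) + 1) * m' = (j : ℕ) + 1 then c k else 0, ?_⟩
  set D : ℝ → ℝ := fun x ↦ (Ioc (0 : ℝ) 1).indicator 1 x -
    ∑ k : Fin N, c k * Int.fract (1 / (((k : ℕ) + 1 : ℝ) * x)) with hD
  have hDm : Measurable D := by
    refine (measurable_one.indicator measurableSet_Ioc).sub (Finset.measurable_sum _ fun k _ ↦ ?_)
    exact measurable_const.mul (measurable_fract.comp (by fun_prop))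
  have hcomp : (fun x : ℝ ↦ (a * (Ioc (0 : ℝ) 1).indicator 1 ((m : ℝ) * x) +
        b * (Ioc (0 : ℝ) 1).indicator 1 ((m' : ℝ) * x)) -
      ∑ j : Fin ((m + m') * N),
        (a * (∑ k : Fin N, if ((k : ℕ) + 1) * m = (j : ℕ) + 1 then c k else 0) +
            b * ∑ k : Fin N, if ((k : ℕ) + 1) * m' = (j : ℕ) + 1 then c k else 0) *
          Int.fract (1 / (((j : ℕ) + 1 : ℝ) * x))) =
      (a • fun x ↦ D ((m : ℝ) * x)) + b • fun x ↦ D ((m' : ℝ) * x) := by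
    funext x
    have hM : m * N ≤ (m + m') * N := Nat.mul_le_mul_right _ (Nat.le_add_right m m')
    have hM' : m' * N ≤ (m + m') * N := Nat.mul_le_mul_right _ (Nat.le_add_left m' m)
    rw [sum_twoDilates_eq c a b hm hm' hM hM' x]
    simp only [Pi.add_apply, Pi.smul_apply, smul_eq_mul, hD]
    ring
  rw [hcomp]
  have hA : AEStronglyMeasurable (a • fun x ↦ D ((m : ℝ) * x)) (volume.restrict (Ioi 0)) :=
    ((hDm.comp (measurable_const_mul _)).const_smul a).aestronglyMeasurable
  have hB : AEStronglyMeasurable (b • fun x ↦ D ((m' : ℝ) * x)) (volume.restrict (Ioi 0)) :=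
    ((hDm.comp (measurable_const_mul _)).const_smul b).aestronglyMeasurable
  have hfac : ∀ {r : ℝ}, 1 ≤ r → ENNReal.ofReal r⁻¹ ^ (1 / 2 : ℝ) ≤ 1 := by
    intro r hr
    exact ENNReal.rpow_le_one (ENNReal.ofReal_le_one.2 (inv_le_one_of_one_le₀ hr)) (by norm_num)
  have hm1 : (1 : ℝ) ≤ m := by exact_mod_cast hm
  have hm1' : (1 : ℝ) ≤ m' := by exact_mod_cast hm'
  have hsum : ‖a‖ₑ * ENNReal.ofReal η + ‖b‖ₑ * ENNReal.ofReal η < ENNReal.ofReal ε := by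
    rw [Real.enorm_eq_ofReal_abs, Real.enorm_eq_ofReal_abs, ← ENNReal.ofReal_mul (abs_nonneg a),
      ← ENNReal.ofReal_mul (abs_nonneg b), ← ENNReal.ofReal_add (by positivity) (by positivity),
      ENNReal.ofReal_lt_ofReal_iff hε]
    have hab : 0 < |a| + |b| + 1 := by positivity
    calc |a| * η + |b| * η = (|a| + |b|) * η := by ring
      _ < (|a| + |b| + 1) * η := mul_lt_mul_of_pos_right (by linarith) hη0
      _ = ε / 2 := by rw [hη]; field_simp
      _ < ε := by linarith
  calc eLpNorm ((a • fun x ↦ D ((m : ℝ) * x)) + b • fun x ↦ D ((m' : ℝ) * x)) 2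
        (volume.restrict (Ioi 0))
      ≤ eLpNorm (a • fun x ↦ D ((m : ℝ) * x)) 2 (volume.restrict (Ioi 0)) +
          eLpNorm (b • fun x ↦ D ((m' : ℝ) * x)) 2 (volume.restrict (Ioi 0)) :=
        eLpNorm_add_le hA hB one_le_two
    _ = ‖a‖ₑ * (ENNReal.ofReal (m : ℝ)⁻¹ ^ (1 / 2 : ℝ) * eLpNorm D 2 (volume.restrict (Ioi 0))) +
          ‖b‖ₑ * (ENNReal.ofReal (m' : ℝ)⁻¹ ^ (1 / 2 : ℝ) *
            eLpNorm D 2 (volume.restrict (Ioi 0))) := by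
        rw [eLpNorm_const_smul, eLpNorm_const_smul, eLpNorm_comp_mul_left_Ioi hDm hm0,
          eLpNorm_comp_mul_left_Ioi hDm hm0']
    _ ≤ ‖a‖ₑ * (1 * eLpNorm D 2 (volume.restrict (Ioi 0))) +
          ‖b‖ₑ * (1 * eLpNorm D 2 (volume.restrict (Ioi 0))) := by
        gcongr
        · exact hfac hm1
        · exact hfac hm1'
    _ ≤ ‖a‖ₑ * ENNReal.ofReal η + ‖b‖ₑ * ENNReal.ofReal η := by
        rw [one_mul]
        gcongr
    _ < ENNReal.ofReal ε := hsum

/-- **RH ⟹ every cell is a Nyman–Beurling target.**  Under RH, for every `m ≥ 1` the cell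
indicator `𝟙_(1/(m+1),1/m] = χ(mx) - χ((m+1)x)` is an `L²(0,∞)`-limit of real combinations
`∑_{j<N} c_j{1/((j+1)x)}` (`nbTarget_twoDilates_of_rh` with `(a,b,m,m') = (1,-1,m,m+1)`).  With
`NbTargets.riemannHypothesis_of_nbTarget_indicator` this makes «`𝟙_(1/(m+1),1/m] ∈ B̄`» an
RH-EQUIVALENT for every `m ≥ 1` (`nbTarget_cell_iff`).
[cite: BaezDuarte2003, Thm. 1.1; Balazard2020, Prop. 10 (i)] -/
theorem nbTarget_cell_of_rh (hRH : RiemannHypothesis) {m : ℕ} (hm : 0 < m) :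
    ∀ ε : ℝ, 0 < ε → ∃ (N : ℕ) (c : Fin N → ℝ),
      eLpNorm (fun x : ℝ ↦ (Ioc (1 / ((m : ℝ) + 1)) (1 / (m : ℝ))).indicator 1 x -
          ∑ k : Fin N, c k * Int.fract (1 / (((k : ℕ) + 1 : ℝ) * x))) 2
        (volume.restrict (Ioi 0)) < ENNReal.ofReal ε := by
  have hm0 : (0 : ℝ) < m := by exact_mod_cast hm
  have hm1 : (0 : ℝ) < (m : ℝ) + 1 := by positivity
  -- the cell indicator is the difference of the two dilates of `χ`
  have hcell : ∀ x : ℝ, (Ioc (1 / ((m : ℝ) + 1)) (1 / (m : ℝ))).indicator (1 : ℝ → ℝ) x =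
      1 * (Ioc (0 : ℝ) 1).indicator 1 ((m : ℝ) * x) +
        (-1) * (Ioc (0 : ℝ) 1).indicator 1 ((((m + 1 : ℕ) : ℕ) : ℝ) * x) := by
    intro x
    rw [Nat.cast_add, Nat.cast_one, ← indicator_Ioc_dilate hm0, ← indicator_Ioc_dilate hm1, one_mul,
      neg_one_mul, ← sub_eq_add_neg]
    have hlt : 1 / ((m : ℝ) + 1) < 1 / (m : ℝ) := one_div_lt_one_div_of_lt hm0 (lt_add_one _)
    by_cases hx : x ∈ Ioc (1 / ((m : ℝ) + 1)) (1 / (m : ℝ))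
    · have h1 : x ∈ Ioc (0 : ℝ) (1 / m) := ⟨(one_div_pos.2 hm1).trans hx.1, hx.2⟩
      have h2 : x ∉ Ioc (0 : ℝ) (1 / ((m : ℝ) + 1)) := fun h' ↦ absurd h'.2 (not_le.2 hx.1)
      rw [indicator_of_mem hx, indicator_of_mem h1, indicator_of_notMem h2, sub_zero]
    · rw [indicator_of_notMem hx]
      by_cases h2 : x ∈ Ioc (0 : ℝ) (1 / ((m : ℝ) + 1))
      · have h1 : x ∈ Ioc (0 : ℝ) (1 / m) := ⟨h2.1, h2.2.trans hlt.le⟩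
        rw [indicator_of_mem h1, indicator_of_mem h2, sub_self]
      · have h1 : x ∉ Ioc (0 : ℝ) (1 / m) := fun h' ↦ by
          rcases le_or_gt x (1 / ((m : ℝ) + 1)) with hle | hgt
          · exact h2 ⟨h'.1, hle⟩
          · exact hx ⟨hgt, h'.2⟩
        rw [indicator_of_notMem h1, indicator_of_notMem h2, sub_zero]
  simp_rw [hcell]
  exact nbTarget_twoDilates_of_rh hRH 1 (-1) hm (Nat.succ_pos m)

/-- **RH-EQUIVALENT (initial segments).**  For every `m ≥ 1`:
«`𝟙_(0,1/m]` is an `L²(0,∞)`-limit of real combinations `∑_{k<N} c_k{1/((k+1)x)}`» `⟺` RH.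
`m = 1` is Báez-Duarte's theorem (`Literature.NumberTheory.LFunctions.baezDuarte_iff_holds`);
`⟹` is RH-free Mellin confinement with empty FIN (`riemannHypothesis_of_nbTarget_indicator_zero`),
`⟸` is dilation (`nbTarget_indicator_of_rh`).
[cite: BaezDuarte2003, Thm. 1.1; Balazard2020, Prop. 10 (i)] -/
theorem nbTarget_indicator_iff {m : ℕ} (hm : 0 < m) :
    (∀ ε : ℝ, 0 < ε → ∃ (N : ℕ) (c : Fin N → ℝ),
      eLpNorm (fun x : ℝ ↦ (Ioc (0 : ℝ) (1 / m)).indicator 1 x -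
          ∑ k : Fin N, c k * Int.fract (1 / (((k : ℕ) + 1 : ℝ) * x))) 2
        (volume.restrict (Ioi 0)) < ENNReal.ofReal ε) ↔ RiemannHypothesis := by
  have hm0 : (0 : ℝ) < m := by exact_mod_cast hm
  have hm1 : (1 : ℝ) ≤ m := by exact_mod_cast hm
  exact ⟨riemannHypothesis_of_nbTarget_indicator_zero (one_div_pos.2 hm0)
    ((div_le_one hm0).2 hm1), fun hRH ↦ nbTarget_indicator_of_rh hRH hm⟩

/-- **RH-EQUIVALENT (single cells).**  For every `m ≥ 1`:
«`𝟙_(1/(m+1),1/m]` is an `L²(0,∞)`-limit of real combinations `∑_{k<N} c_k{1/((k+1)x)}`» `⟺` RH.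
`⟹`: RH-free Mellin confinement, FIN empty since `((1/m)^s - (1/(m+1))^s)/s ≠ 0` for `Re s > 0`
(`riemannHypothesis_of_nbTarget_indicator`); `⟸`: `nbTarget_cell_of_rh`.  In print this is
Balazard's «B̄ = D ⟺ RH» read on one basis vector `ε_m` of `D_0`.
[cite: Balazard2020, Prop. 10 (i); BaezDuarte2003, Thm. 1.1] -/
theorem nbTarget_cell_iff {m : ℕ} (hm : 0 < m) :
    (∀ ε : ℝ, 0 < ε → ∃ (N : ℕ) (c : Fin N → ℝ),
      eLpNorm (fun x : ℝ ↦ (Ioc (1 / ((m : ℝ) + 1)) (1 / (m : ℝ))).indicator 1 x -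
          ∑ k : Fin N, c k * Int.fract (1 / (((k : ℕ) + 1 : ℝ) * x))) 2
        (volume.restrict (Ioi 0)) < ENNReal.ofReal ε) ↔ RiemannHypothesis := by
  have hm0 : (0 : ℝ) < m := by exact_mod_cast hm
  have hm1 : (1 : ℝ) ≤ m := by exact_mod_cast hm
  exact ⟨riemannHypothesis_of_nbTarget_indicator (one_div_pos.2 (by positivity))
    (one_div_lt_one_div_of_lt hm0 (lt_add_one _)) ((div_le_one hm0).2 hm1),
    fun hRH ↦ nbTarget_cell_of_rh hRH hm⟩

end Summit.RiemannHypothesis.RiemannHypothesis.Theorems.Splittings.NbTargets
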